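import Literature.NumberTheory.DiophantineApproximation.MCFAlgorithm
import Mathlib.LinearAlgebra.Matrix.Transvection
import Mathlib.LinearAlgebra.Matrix.Permutation
import Mathlib.LinearAlgebra.Matrix.Notation
import Mathlib.GroupTheory.Perm.Fin
import Mathlib.Logic.Equiv.Fin.Rotate
import HarnessLib

/-!
# Classical multidimensional continued fraction algorithms as `MCFAlgorithm`s

Instances of `Literature.NumberTheory.DiophantineApproximation.MCFAlgorithm`
(coordinate `0` = denominator coordinate, the map on piece `j` is `v ↦ A_j⁻¹ v`):

* `gauss : MCFAlgorithm 1 ℕ` — the regular continued fraction (Euclid / Gauss map) in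
  homogeneous form: on `a v₁ ≤ v₀ < (a+1) v₁` the step is `(v₀, v₁) ↦ (v₁, v₀ - a v₁)` with
  `A_a = !![a, 1; 1, 0]`, so that `A_{a₁} ⋯ A_{a_t} = !![q_t, q_{t-1}; p_t, p_{t-1}]` for
  `α = [0; a₁, a₂, …]` [Karpenkov2013, Example 27.55]; infinitely many pieces. This is the
  `d = 1` case of Jacobi–Perron.
* `farey : MCFAlgorithm 1 (Fin 2)` — the additive (subtractive) Euclid algorithm, two pieces
  `v₀ ≥ v₁ > 0` (step `(v₀ - v₁, v₁)`) and `v₁ > v₀ > 0` (step `(v₀, v₁ - v₀)`); the `d = 1`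
  case of Brun / Selmer [folklore].
* `jacobiPerron d : MCFAlgorithm d (Fin d → ℕ)` — [Karpenkov2013, Example 27.56]: subtract
  `⌊x₀/x₁⌋ x₁` from `x₀` and `⌊xᵢ/x₁⌋ x₁` from `xᵢ` (`i ≥ 2`), then shift cyclically
  `(x₀, …, x_d) ↦ (x₁, …, x_d, x₀)`; the digit is the vector of the `d` partial quotients;
  termination domain `x₁ = 0` (left uncovered). Infinitely many pieces (a *multiplicative*
  algorithm).
* `sortedSubtractive d p` — the generalised `p`-subtractive algorithm on the sorted cone
  `x₀ ≥ x₁ ≥ ⋯ ≥ x_d ≥ 0` [Karpenkov2013, Example 27.58]: replace `x₀` by `x₀ - x_p` and re-sort;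
  the digit `a ∈ Fin (d+1)` is the position at which `x₀ - x_p` is re-inserted; termination
  domain `x_p = 0`. `brunSorted` is `p = 1` (Brun 1919/1957) and `selmerSorted` is `p = d`
  (Mönkemeyer, Selmer 1961) [Karpenkov2013, Remark 27.59]; compare [Thuswaldner2020, Example 3.4.4]
  (Brun for `d = 2`, written with increasing coordinates). Finitely many (`d+1`) pieces.
* `brunUnsorted d`, `selmerUnsorted d` — the symmetric versions on the positive cone
  [Labbe2015, §§1–2]: on the open cone `x_{π 0} < x_{π 1} < ⋯ < x_{π (d+1)}` subtract the second
  largest (Brun), resp. the smallest (Selmer), coordinate from the largest; `A_π` is the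
  corresponding elementary matrix (`M_π` of [Labbe2015]); `(d+2)!` pieces, ties uncovered.

All matrices are products of a transvection and a permutation matrix, whence unimodular.
Conventions on boundary points (ties), which the sources leave unspecified or treat as a null
set, are documented at each definition.

## References

* [Karpenkov2013] O. Karpenkov, *Geometry of Continued Fractions*, Springer 2013, §27.4.2.
* [Thuswaldner2020] J. Thuswaldner, in: Substitution and Tiling Dynamics, LNM 2273 (2020), Ex. 3.4.4.
* [Labbe2015] S. Labbé, *3-dimensional continued fraction algorithms cheat sheets*,
  arXiv:1511.08399, §1 (Brun), §2 (Selmer).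
* [Schweiger2000] F. Schweiger, *Multidimensional Continued Fractions*, OUP 2000 (not held).
-/

namespace Literature.NumberTheory.DiophantineApproximation

namespace MCFAlgorithm

open Matrix Equiv

variable {d : ℕ}

/-! ### Integer rows and unimodularity helpers -/

/-- The `i`-th unit row `e_i` (so that `eval (unitRow i) v = v i`). [folklore] -/
def unitRow (i : Fin (d + 1)) : Fin (d + 1) → ℤ := Pi.single i 1

section Eval

variable {K : Type*} [CommRing K]

/-- `eval (unitRow i) v = v i`. [folklore] -/
@[simp] theorem eval_unitRow (i : Fin (d + 1)) (v : Fin (d + 1) → K) :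
    MCFConstraint.eval (unitRow i) v = v i := by
  classical
  simp [MCFConstraint.eval, unitRow, Pi.single_apply]

/-- `eval` is additive in the row. [folklore] -/
@[simp] theorem eval_add (c c' : Fin (d + 1) → ℤ) (v : Fin (d + 1) → K) :
    MCFConstraint.eval (c + c') v = MCFConstraint.eval c v + MCFConstraint.eval c' v := by
  simp [MCFConstraint.eval, add_mul, Finset.sum_add_distrib]

/-- `eval` is subtractive in the row. [folklore] -/
@[simp] theorem eval_sub (c c' : Fin (d + 1) → ℤ) (v : Fin (d + 1) → K) :
    MCFConstraint.eval (c - c') v = MCFConstraint.eval c v - MCFConstraint.eval c' v := by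
  simp [MCFConstraint.eval, sub_mul, Finset.sum_sub_distrib]

/-- `eval` commutes with integer scaling of the row. [folklore] -/
@[simp] theorem eval_zsmul (n : ℤ) (c : Fin (d + 1) → ℤ) (v : Fin (d + 1) → K) :
    MCFConstraint.eval (n • c) v = n * MCFConstraint.eval c v := by
  simp [MCFConstraint.eval, Finset.mul_sum, mul_assoc]

end Eval

/-- Permutation matrices are unimodular over `ℤ`. [folklore] -/
theorem isUnit_det_permMatrix (σ : Perm (Fin (d + 1))) : IsUnit (σ.permMatrix ℤ).det := by
  rw [Matrix.det_permutation]
  exact Units.isUnit _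

/-- A transvection times a permutation matrix is unimodular. [folklore] -/
theorem isUnit_det_transvection_mul_permMatrix {i j : Fin (d + 1)} (h : i ≠ j) (c : ℤ)
    (σ : Perm (Fin (d + 1))) : IsUnit (transvection i j c * σ.permMatrix ℤ).det := by
  rw [Matrix.det_mul, Matrix.det_transvection_of_ne _ _ h, one_mul]
  exact isUnit_det_permMatrix σ

/-- A product of unimodular matrices is unimodular. [folklore] -/
theorem isUnit_det_list_prod {l : List (Matrix (Fin (d + 1)) (Fin (d + 1)) ℤ)}
    (h : ∀ M ∈ l, IsUnit M.det) : IsUnit l.prod.det := by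
  induction l with
  | nil => simp
  | cons M l ih =>
    rw [List.prod_cons, Matrix.det_mul]
    exact (h M (by simp)).mul (ih fun N hN => h N (by simp [hN]))

/-! ### `d = 1`: Gauss and Farey -/

/-- The **Gauss map** (regular continued fraction) as an MCF algorithm in dimension `1` with
pieces `a ∈ ℕ`: piece `a` is `a v₁ ≤ v₀ < (a + 1) v₁` (i.e. `⌊v₀ / v₁⌋ = a`, forcing `v₁ > 0`),
with partial-quotient matrix `A_a = !![a, 1; 1, 0]` and step `(v₀, v₁) ↦ (v₁, v₀ - a v₁)`
(`gauss_inv`). Starting from `homog α = (1, α)`, `0 < α < 1`, the digits are the partial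
quotients `a₁, a₂, …` of `α` and the columns of the convergent matrices are `(q_t, p_t)`,
`(q_{t-1}, p_{t-1})`; the termination domain `v₁ = 0` is uncovered (rational `α` terminate).
Piece `0` (`v₀ < v₁`, i.e. `α > 1`) swaps the coordinates. [cite: Karpenkov2013, Example 27.55] -/
def gauss : MCFAlgorithm 1 ℕ where
  mat a := !![(a : ℤ), 1; 1, 0]
  isUnit_det a := by
    show IsUnit ((!![(a : ℤ), 1; 1, 0] : Matrix (Fin 2) (Fin 2) ℤ).det)
    simp [Matrix.det_fin_two_of]
  piece a := [(![1, -(a : ℤ)], false), (![-1, (a : ℤ) + 1], true)]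

/-- The Gauss step matrix: `A_a⁻¹ = !![0, 1; 1, -a]`, i.e. `(v₀, v₁) ↦ (v₁, v₀ - a v₁)`.
[cite: Karpenkov2013, Example 27.55] -/
theorem gauss_inv (a : ℕ) : gauss.inv a = !![0, 1; 1, -(a : ℤ)] := by
  refine Matrix.inv_eq_left_inv ?_
  show (!![0, 1; 1, -(a : ℤ)] : Matrix (Fin 2) (Fin 2) ℤ) * !![(a : ℤ), 1; 1, 0] = 1
  simp [Matrix.one_fin_two]

/-- Evaluating a row in dimension `1`: `eval ![c₀, c₁] v = c₀ v₀ + c₁ v₁`. [folklore] -/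
theorem eval_fin_two {K : Type*} [CommRing K] (c₀ c₁ : ℤ) (v : Fin 2 → K) :
    MCFConstraint.eval (d := 1) ![c₀, c₁] v = c₀ * v 0 + c₁ * v 1 := by
  simp [MCFConstraint.eval, Fin.sum_univ_succ]

/-- Membership in the Gauss piece `a`: `a v₁ ≤ v₀ < (a + 1) v₁`. [cite: Karpenkov2013, Example 27.55] -/
theorem gauss_memPiece_iff {K : Type*} [CommRing K] [LinearOrder K] [IsStrictOrderedRing K]
    (a : ℕ) (v : Fin 2 → K) :
    gauss.MemPiece a v ↔ (a : K) * v 1 ≤ v 0 ∧ v 0 < ((a : K) + 1) * v 1 := by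
  simp only [MemPiece, gauss, List.mem_cons, List.not_mem_nil, or_false, forall_eq_or_imp,
    forall_eq, MCFConstraint.holds_false_iff, MCFConstraint.holds_true_iff, eval_fin_two]
  push_cast
  constructor <;> rintro ⟨h₁, h₂⟩ <;> constructor <;> linarith

/-- The Gauss pieces are pairwise disjoint (a genuine partition of `v₁ > 0`), so the digit of
`v` with `v₁ > 0` is `⌊v₀ / v₁⌋`. [cite: Karpenkov2013, Example 27.55] -/
theorem gauss_piecesDisjoint (K : Type*) [CommRing K] [LinearOrder K] [IsStrictOrderedRing K] :
    gauss.PiecesDisjoint K := by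
  intro v a a' ha ha'
  rw [gauss_memPiece_iff] at ha ha'
  have hv : 0 < v 1 := by linarith [lt_of_le_of_lt ha.1 ha.2]
  have h1 : (a : K) < (a' : K) + 1 := lt_of_mul_lt_mul_right (lt_of_le_of_lt ha.1 ha'.2) hv.le
  have h2 : (a' : K) < (a : K) + 1 := lt_of_mul_lt_mul_right (lt_of_le_of_lt ha'.1 ha.2) hv.le
  have h1' : a < a' + 1 := by exact_mod_cast h1
  have h2' : a' < a + 1 := by exact_mod_cast h2
  omega

/-- The **Farey (additive Euclid) map** in dimension `1`: piece `0` is `v₀ ≥ v₁ > 0` with step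
`(v₀, v₁) ↦ (v₀ - v₁, v₁)` (`A₀ = !![1, 1; 0, 1]`), piece `1` is `v₁ > v₀ > 0` with step
`(v₀, v₁) ↦ (v₀, v₁ - v₀)` (`A₁ = !![1, 0; 1, 1]`); the columns of the convergent matrices
are the two Farey (Stern–Brocot) fractions currently bracketing `α`, among them all
continued-fraction convergents. The faces `v₀ = 0`, `v₁ = 0` are uncovered (termination).
This is `d = 1` of the subtractive algorithms below. [folklore] -/
def farey : MCFAlgorithm 1 (Fin 2) where
  mat := ![!![1, 1; 0, 1], !![1, 0; 1, 1]]
  isUnit_det j := by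
    fin_cases j
    · show IsUnit ((!![1, 1; 0, 1] : Matrix (Fin 2) (Fin 2) ℤ).det)
      simp [Matrix.det_fin_two_of]
    · show IsUnit ((!![1, 0; 1, 1] : Matrix (Fin 2) (Fin 2) ℤ).det)
      simp [Matrix.det_fin_two_of]
  piece := ![[(![1, -1], false), (![0, 1], true)], [(![-1, 1], true), (![1, 0], true)]]

/-- The Farey step matrices: `A₀⁻¹ = !![1, -1; 0, 1]` and `A₁⁻¹ = !![1, 0; -1, 1]`. [folklore] -/
theorem farey_inv : farey.inv 0 = !![1, -1; 0, 1] ∧ farey.inv 1 = !![1, 0; -1, 1] := by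
  constructor
  · refine Matrix.inv_eq_left_inv ?_
    ext i j
    fin_cases i <;> fin_cases j <;> simp [farey, Matrix.mul_apply, Fin.sum_univ_succ]
  · refine Matrix.inv_eq_left_inv ?_
    ext i j
    fin_cases i <;> fin_cases j <;> simp [farey, Matrix.mul_apply, Fin.sum_univ_succ]

/-- Membership in Farey piece `0`: `v₀ ≥ v₁ > 0`. [folklore] -/
theorem farey_memPiece_zero_iff {K : Type*} [CommRing K] [LinearOrder K] [IsStrictOrderedRing K]
    (v : Fin 2 → K) : farey.MemPiece 0 v ↔ v 1 ≤ v 0 ∧ 0 < v 1 := by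
  change (∀ c ∈ [((![1, -1] : Fin 2 → ℤ), false), (![0, 1], true)], MCFConstraint.Holds c v) ↔ _
  simp only [List.forall_mem_cons, List.not_mem_nil, false_implies, implies_true, and_true,
    MCFConstraint.holds_false_iff, MCFConstraint.holds_true_iff, eval_fin_two]
  push_cast
  constructor <;> rintro ⟨h₁, h₂⟩ <;> constructor <;> linarith

/-- Membership in Farey piece `1`: `v₁ > v₀ > 0`. [folklore] -/
theorem farey_memPiece_one_iff {K : Type*} [CommRing K] [LinearOrder K] [IsStrictOrderedRing K]
    (v : Fin 2 → K) : farey.MemPiece 1 v ↔ v 0 < v 1 ∧ 0 < v 0 := by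
  change (∀ c ∈ [((![-1, 1] : Fin 2 → ℤ), true), (![1, 0], true)], MCFConstraint.Holds c v) ↔ _
  simp only [List.forall_mem_cons, List.not_mem_nil, false_implies, implies_true, and_true,
    MCFConstraint.holds_true_iff, eval_fin_two]
  push_cast
  constructor <;> rintro ⟨h₁, h₂⟩ <;> constructor <;> linarith

/-- The two Farey pieces are disjoint (a genuine partition of the open positive quadrant).
[folklore] -/
theorem farey_piecesDisjoint (K : Type*) [CommRing K] [LinearOrder K] [IsStrictOrderedRing K] :
    farey.PiecesDisjoint K := by
  intro v j j' hj hj'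
  fin_cases j <;> fin_cases j'
  · rfl
  · exact absurd (farey_memPiece_zero_iff v |>.1 hj).1 (not_le.2 (farey_memPiece_one_iff v |>.1 hj').1)
  · exact absurd (farey_memPiece_zero_iff v |>.1 hj').1 (not_le.2 (farey_memPiece_one_iff v |>.1 hj).1)
  · rfl

/-! ### Jacobi–Perron -/

/-- The **Jacobi–Perron algorithm** in dimension `d` [Karpenkov2013, Example 27.56] (coordinates
`(x₀, x₁, …, x_d)`, `x₀` the denominator coordinate). The digit is the vector
`a = (⌊x₀/x₁⌋, ⌊x₂/x₁⌋, …, ⌊x_d/x₁⌋) ∈ ℕ^d` (component `i : Fin d` concerns the coordinate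
`Fin.succAbove 1 i`, i.e. `0 ↦ 0` and `i ↦ i + 1` for `i ≥ 1`); piece `a` is cut out by
`aᵢ x₁ ≤ x_{t(i)} < (aᵢ + 1) x₁` for all `i` (forcing `x₁ > 0`); the step subtracts `aᵢ x₁`
from `x_{t(i)}` and then shifts cyclically, `(x₀, x₁, …, x_d) ↦ (x₁, x₂, …, x_d, x₀)`, so the
partial-quotient matrix is `A_a = (∏ᵢ transvection t(i) 1 aᵢ) * P`, `P` the permutation matrix
of the inverse cyclic shift. The termination domain `x₁ = 0` [Karpenkov2013, Remark 27.57] is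
uncovered. For `d = 1` this is `gauss` (`A_a = !![a, 1; 1, 0]`). Infinitely many pieces.
[cite: Karpenkov2013, Example 27.56] -/
def jacobiPerron (d : ℕ) : MCFAlgorithm d (Fin d → ℕ) where
  mat a := ((List.finRange d).map fun i => transvection (Fin.succAbove 1 i) 1 (a i : ℤ)).prod *
    Equiv.Perm.permMatrix ℤ (finRotate (d + 1)).symm
  isUnit_det a := by
    rw [Matrix.det_mul]
    refine IsUnit.mul (isUnit_det_list_prod fun M hM => ?_) (isUnit_det_permMatrix _)
    obtain ⟨i, -, rfl⟩ := List.mem_map.1 hM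
    rw [Matrix.det_transvection_of_ne _ _ (Fin.succAbove_ne 1 i)]
    exact isUnit_one
  piece a := (List.finRange d).flatMap fun i =>
    [(unitRow (Fin.succAbove 1 i) - (a i : ℤ) • unitRow 1, false),
      (((a i : ℤ) + 1) • unitRow 1 - unitRow (Fin.succAbove 1 i), true)]

/-- Membership in the Jacobi–Perron piece `a`: `aᵢ x₁ ≤ x_{t(i)} < (aᵢ + 1) x₁` for every `i`.
[cite: Karpenkov2013, Example 27.56] -/
theorem jacobiPerron_memPiece_iff {K : Type*} [CommRing K] [LinearOrder K] [IsStrictOrderedRing K]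
    (a : Fin d → ℕ) (v : Fin (d + 1) → K) :
    (jacobiPerron d).MemPiece a v ↔
      ∀ i : Fin d, (a i : K) * v 1 ≤ v (Fin.succAbove 1 i) ∧ v (Fin.succAbove 1 i) < ((a i : K) + 1) * v 1 := by
  simp only [MemPiece, jacobiPerron, List.mem_flatMap, List.mem_finRange, true_and, List.mem_cons,
    List.not_mem_nil, or_false, forall_exists_index]
  constructor
  · intro h i
    have h₁ := h _ i (Or.inl rfl)
    have h₂ := h _ i (Or.inr rfl)
    simp only [MCFConstraint.holds_false_iff, MCFConstraint.holds_true_iff, eval_sub, eval_unitRow,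
      eval_zsmul] at h₁ h₂
    push_cast at h₁ h₂
    constructor <;> linarith
  · rintro h c i (rfl | rfl)
    · simp only [MCFConstraint.holds_false_iff, eval_sub, eval_unitRow, eval_zsmul]
      push_cast
      linarith [(h i).1]
    · simp only [MCFConstraint.holds_true_iff, eval_sub, eval_unitRow, eval_zsmul]
      push_cast
      linarith [(h i).2]

/-- The Jacobi–Perron pieces are pairwise disjoint (distinct digit vectors have distinct floor
conditions), so the digit of `v` with `x₁ > 0` is determined by membership.
[cite: Karpenkov2013, Example 27.56] -/
theorem jacobiPerron_piecesDisjoint (K : Type*) [CommRing K] [LinearOrder K] [IsStrictOrderedRing K] :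
    (jacobiPerron d).PiecesDisjoint K := by
  intro v a a' ha ha'
  rw [jacobiPerron_memPiece_iff] at ha ha'
  funext i
  have h1 := ha i
  have h2 := ha' i
  have hv : 0 < v 1 := by linarith [lt_of_le_of_lt h1.1 h1.2]
  have e1 : (a i : K) < (a' i : K) + 1 := lt_of_mul_lt_mul_right (lt_of_le_of_lt h1.1 h2.2) hv.le
  have e2 : (a' i : K) < (a i : K) + 1 := lt_of_mul_lt_mul_right (lt_of_le_of_lt h2.1 h1.2) hv.le
  have e1' : a i < a' i + 1 := by exact_mod_cast e1
  have e2' : a' i < a i + 1 := by exact_mod_cast e2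
  omega

/-! ### Sorted `p`-subtractive algorithms: Brun and Selmer -/

/-- The constraints `x₀ ≥ x₁ ≥ ⋯ ≥ x_d ≥ 0` of the sorted cone. [cite: Karpenkov2013, Example 27.58] -/
def sortedRows (d : ℕ) : List (MCFConstraint d) :=
  ((List.finRange d).map fun i => (unitRow i.castSucc - unitRow i.succ, false))
    ++ [(unitRow (Fin.last d), false)]

/-- The **generalised `p`-subtractive algorithm** on the sorted cone `x₀ ≥ x₁ ≥ ⋯ ≥ x_d ≥ 0`
[Karpenkov2013, Example 27.58] (`p : Fin d` stands for the coordinate `p + 1 ∈ {1, …, d}`):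
replace `x₀` by `y = x₀ - x_{p+1}` and re-sort in non-increasing order. The digit `a : Fin (d+1)`
is the position of `y` after re-sorting; our tie-break: `y` is inserted *after* all coordinates
`≥ y`, i.e. piece `a` is `{sorted} ∩ {x_{p+1} > 0} ∩ {x_a ≥ y (if a ≠ 0)} ∩ {y > x_{a+1} (if a ≠ d)}`,
a genuine partition of the sorted cone minus the termination domain `x_{p+1} = 0` (uncovered).
The step is `x ↦ (x₁, …, x_a, y, x_{a+1}, …, x_d)`, so the partial-quotient matrix is
`A_a = transvection 0 (p+1) 1 * P_{σ⁻¹}` with `σ = Fin.cycleRange a` the cycle `(0 1 ⋯ a)`.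
[cite: Karpenkov2013, Example 27.58] -/
def sortedSubtractive (d : ℕ) (p : Fin d) : MCFAlgorithm d (Fin (d + 1)) where
  mat a := transvection 0 p.succ 1 * Equiv.Perm.permMatrix ℤ (Fin.cycleRange a).symm
  isUnit_det a :=
    isUnit_det_transvection_mul_permMatrix (Fin.succ_ne_zero p).symm 1 (Fin.cycleRange a).symm
  piece a := sortedRows d ++ [(unitRow p.succ, true)]
    ++ (if a = 0 then [] else [(unitRow a - unitRow 0 + unitRow p.succ, false)])
    ++ (if h : a = Fin.last d then []
        else [(unitRow 0 - unitRow p.succ - unitRow ((a.castPred h).succ), true)])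

/-- Membership in piece `a` of the sorted `p`-subtractive algorithm: `v` is sorted and
non-negative, `v_{p+1} > 0`, and `y = v₀ - v_{p+1}` satisfies `v_a ≥ y` (if `a ≠ 0`) and
`y > v_{a+1}` (if `a ≠ d`). [cite: Karpenkov2013, Example 27.58] -/
theorem sortedSubtractive_memPiece_iff {K : Type*} [CommRing K] [LinearOrder K]
    [IsStrictOrderedRing K] (p : Fin d) (a : Fin (d + 1)) (v : Fin (d + 1) → K) :
    (sortedSubtractive d p).MemPiece a v ↔
      ((∀ i : Fin d, v i.succ ≤ v i.castSucc) ∧ 0 ≤ v (Fin.last d)) ∧ 0 < v p.succ ∧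
      (a ≠ 0 → v 0 - v p.succ ≤ v a) ∧
      (∀ h : a ≠ Fin.last d, v (a.castPred h).succ < v 0 - v p.succ) := by
  have hA : (∀ x ∈ (if a = 0 then ([] : List (MCFConstraint d))
        else [(unitRow a - unitRow 0 + unitRow p.succ, false)]), MCFConstraint.Holds x v) ↔
      (a ≠ 0 → v 0 - v p.succ ≤ v a) := by
    split_ifs with h
    · simp [h]
    · simp only [List.forall_mem_cons, List.not_mem_nil, false_implies, implies_true, and_true,
        MCFConstraint.holds_false_iff, eval_add, eval_sub, eval_unitRow, ne_eq, h,
        not_false_eq_true, true_implies]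
      constructor <;> intro h' <;> linarith
  have hB : (∀ x ∈ (if h : a = Fin.last d then ([] : List (MCFConstraint d))
        else [(unitRow 0 - unitRow p.succ - unitRow (a.castPred h).succ, true)]),
        MCFConstraint.Holds x v) ↔
      (∀ h : a ≠ Fin.last d, v (a.castPred h).succ < v 0 - v p.succ) := by
    split_ifs with h
    · simp [h]
    · simp only [List.forall_mem_cons, List.not_mem_nil, false_implies, implies_true, and_true,
        MCFConstraint.holds_true_iff, eval_sub, eval_unitRow, ne_eq]
      constructor
      · intro h' _
        linarith
      · intro h'
        linarith [h' h]
  simp only [MemPiece, sortedSubtractive, sortedRows, List.forall_mem_append, List.forall_mem_map,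
    List.mem_finRange, true_implies, List.forall_mem_cons, List.not_mem_nil, false_implies,
    implies_true, and_true, MCFConstraint.holds_false_iff, MCFConstraint.holds_true_iff,
    eval_sub, eval_unitRow, sub_nonneg, hA, hB, and_assoc]

/-- **Brun's algorithm** (sorted form, dimension `d + 1 ≥ 1`): subtract the second largest
coordinate from the largest and re-sort — the `p`-subtractive algorithm with `p = 1`
[Karpenkov2013, Remark 27.59]; [Thuswaldner2020, Example 3.4.4] is the case `d + 1 = 2` in
increasing coordinates. `d + 2` pieces. [cite: Karpenkov2013, Remark 27.59] -/
def brunSorted (d : ℕ) : MCFAlgorithm (d + 1) (Fin (d + 2)) := sortedSubtractive (d + 1) 0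

/-- **Selmer's algorithm** (sorted form, dimension `d + 1 ≥ 1`): subtract the smallest
coordinate from the largest and re-sort — the `p`-subtractive algorithm with `p = d + 1`
(Mönkemeyer; Selmer 1961) [Karpenkov2013, Remark 27.59]. `d + 2` pieces.
[cite: Karpenkov2013, Remark 27.59] -/
def selmerSorted (d : ℕ) : MCFAlgorithm (d + 1) (Fin (d + 2)) := sortedSubtractive (d + 1) (Fin.last d)

/-! ### Unsorted (symmetric) Brun and Selmer on the positive cone -/

/-- The open cone `x_{π 0} < x_{π 1} < ⋯ < x_{π (d+1)}` of [Labbe2015, §1.2] as constraints.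
[cite: Labbe2015, §1.2] -/
def ascendingRows (d : ℕ) (π : Perm (Fin (d + 2))) : List (MCFConstraint (d + 1)) :=
  (List.finRange (d + 1)).map fun i => (unitRow (π i.succ) - unitRow (π i.castSucc), true)

/-- **Brun's algorithm, unsorted (symmetric) form** on the positive cone of `ℝ^{d+2}`
[Labbe2015, §1]: on the open cone `x_{π 0} < ⋯ < x_{π (d+1)}` (`π` a permutation, `(d+2)!`
pieces) subtract the second largest coordinate `x_{π d}` from the largest `x_{π (d+1)}`; the
partial-quotient matrix is the elementary matrix `M_π = 1 + E_{π(d+1), π(d)}`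
(`= transvection (π (d+1)) (π d) 1`). Ties (a null set) are uncovered, as in the source.
[cite: Labbe2015, §1] -/
def brunUnsorted (d : ℕ) : MCFAlgorithm (d + 1) (Perm (Fin (d + 2))) where
  mat π := transvection (π (Fin.last (d + 1))) (π (Fin.last d).castSucc) 1
  isUnit_det π := by
    rw [Matrix.det_transvection_of_ne]
    · exact isUnit_one
    · exact π.injective.ne (Fin.castSucc_lt_last (Fin.last d)).ne'
  piece π := ascendingRows d π

/-- **Selmer's algorithm, unsorted (symmetric) form** on the positive cone of `ℝ^{d+2}`
[Labbe2015, §2]: on the open cone `x_{π 0} < ⋯ < x_{π (d+1)}` subtract the smallest coordinate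
`x_{π 0}` from the largest `x_{π (d+1)}`; `M_π = 1 + E_{π(d+1), π(0)}`. Ties uncovered.
[cite: Labbe2015, §2] -/
def selmerUnsorted (d : ℕ) : MCFAlgorithm (d + 1) (Perm (Fin (d + 2))) where
  mat π := transvection (π (Fin.last (d + 1))) (π 0) 1
  isUnit_det π := by
    rw [Matrix.det_transvection_of_ne]
    · exact isUnit_one
    · exact π.injective.ne (Fin.last_pos' (n := d + 1)).ne'
  piece π := ascendingRows d π

/-- Membership in the piece `π` of the unsorted algorithms: `x_{π 0} < x_{π 1} < ⋯ < x_{π (d+1)}`.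
[cite: Labbe2015, §1.2] -/
theorem brunUnsorted_memPiece_iff {K : Type*} [CommRing K] [LinearOrder K] [IsStrictOrderedRing K]
    (π : Perm (Fin (d + 2))) (v : Fin (d + 2) → K) :
    (brunUnsorted d).MemPiece π v ↔ ∀ i : Fin (d + 1), v (π i.castSucc) < v (π i.succ) := by
  simp only [MemPiece, brunUnsorted, ascendingRows, List.mem_map, List.mem_finRange, true_and,
    forall_exists_index, forall_apply_eq_imp_iff, MCFConstraint.holds_true_iff, eval_sub, eval_unitRow,
    sub_pos]

end MCFAlgorithm

end Literature.NumberTheory.DiophantineApproximation
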